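import Literature.AnabelianGeometry.EtaleTheta.Discharge.Sec2Prop26Reduction
import Literature.AnabelianGeometry.EtaleTheta.Discharge.Sec2Prop24Prop26ClosureRefuted
import HarnessLib

/-!
# [EtTh] Prop. 2.6 (characteristic nature of the dotted coverings): POINTWISE reductions to print's named
# input, the INNER instance forms (inhabited for every datum), and the pointwise re-close of the node's
# closer of record `prop26_existsUnique` (proof-only companion; 0 definitions)

S. Mochizuki, *The étale theta function and its Frobenioid-theoretic manifestations* [EtTh], Publ. RIMS **45**
(2009), §2, Prop. 2.6, PRIMS p. 266 = PDF p. 40 ll. 8–20 [cite: MochizukiEtTh2009, Prop 2.6 p.40]: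
«any isomorphism of topological groups `γ : Π^tp_{Ẋ̲̲_α} ⥲ Π^tp_{Ẋ̲̲_β}` (respectively, `Ẋ̲`; `Ċ̲̲`; `Ċ̲`)
induces isomorphisms compatible with the various natural maps between the respective "`Π^tp`'s" of `X̲̲`
(respectively, `X̲`; `C̲̲`; `C̲`) and `Ċ`. A similar statement holds when "`Π^tp`" is replaced by "`Π`".»
Printed proof (p. 40 l. 21): «entirely similar to the proofs of Propositions 1.8, 2.4», i.e. (p. 265 ll. 8–20,
p. 254 ll. 25–45): [AbsAnab] Lemma 1.3.8 (`G_K` is preserved); the `K`-CORE `C` (standing hypothesis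
«the hyperbolic curve determined by `X^log` is not `K`-arithmetic», p. 261 l. 3) with [SemiAnbd] Thm. 6.8 (ii)
[cf. [Mzk3] Thm. 2.4] — `γ` INDUCES an isomorphism of the `Π^tp_C`'s compatible with `γ`; then group theory
(index-`2` subgroups whose profinite completion is torsion-free, [Mzk16] Lemma 2.1 (v)) and [SemiAnbd]
Thm. 6.5 (iii) (decomposition groups of cusps are preserved) for the compatibility with the other members.

Cell abc-iut, layer L2, cone node **EtTh:Prop2.6** (seat abc-iut-w6-d082, gen 4; L2-lead ROWS #128 R955
«EtTh:Prop2.6 CENSUS»). Companion of abc-iut-L2-t2's `ThetaCoversTempered.lean` (the one-object typed form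
`TemperedCoverData.Prop26`, FACT-LIST F-0610), abc-iut-L2-t7's `Sec2Prop24Reduction.lean` (`prop26_existsUnique`
= the kernel index's closer of record `N_EtTh_Prop2_6`, which BINDS `h : T.Prop26`) and abc-iut-w6-d084's
`Sec2Prop26Reduction.lean` (`prop26_iff_core`). PURE GROUP THEORY / TOPOLOGY over the interface.

WHAT THIS FILE RECORDS, writing `Ż := Z ∩ Π^tp_Ċ` for a member `Z ∈ {Π^tp_{X̲̲}, Π^tp_{X̲}, Π^tp_{C̲̲}, Π^tp_{C̲}}`:
* §1 `extendsStabilising_dotted_of_extension` (+ `_C` for the `C`-members) — the POINTWISE form of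
  `prop26_of_core`: for ONE member `Z` and ONE automorphism `γ` of `Π^tp_Ż`, the printed conclusion
  `ExtendsStabilising Ż γ [Ż, Z, Ċ]` follows from print's anabelian input in one-object form — an extension
  `Γ ∈ Aut(Π^tp_C)` of `γ` ([SemiAnbd] Thm. 6.8 (ii) at the `K`-core `C`) with `Γ(Π^tp_Z) = Π^tp_Z` (and, for the
  `X`-members only, `Γ(Π^tp_Ċ) = Π^tp_Ċ`; for `Ċ̲̲`, `Ċ̲` that clause is automatic, `map_PiCdot_eq_of_map_inf_PiCdot_eq`).
  These binders are EXACTLY what print's hypotheses leave to prove at a datum; nothing else enters.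
* §2 `extendsStabilising_dotted_of_inner`, `exists_extendsStabilising_dotted_of_mem_normalizer`,
  `extendsStabilising_dotted_refl` — the INNER INSTANCE FORMS: for `γ` the restriction to `Π^tp_Ż` of the inner
  automorphism of `Π^tp_C` by any `n` normalising `Π^tp_Z` (in particular `n ∈ Π^tp_Z`, or `γ = id`), the printed
  conclusion HOLDS for EVERY `TemperedCoverData` — the analogue of abc-iut-L2-t1's `prop18_of_inner` /
  `prop18_refl` for [EtTh] Prop. 1.8 (Remark 2.6.1's «isomorphisms arising from isomorphisms of the orbicurves»).
* §3 `existsUnique_extension_dotted_of_extendsStabilising`, `…_of_inner`, `…_refl` — the node's closer of record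
  `prop26_existsUnique (hslim) (h : T.Prop26)` RE-CLOSED POINTWISE: its conclusion (`∃!` extension stabilising
  `[Ż, Z, Ċ]`) from temp-slimness and the pointwise instance `ExtendsStabilising Ż γ [Ż, Z, Ċ]` in place of the
  whole schema `T.Prop26` (F-0610, whose universal closure is REFUTED: `not_forall_prop26`, and which FAILS at the
  κ′ cover datum, `SettingModel.not_prop26_temperedCoverData_inversionModelκ'`); the instance binder is
  INHABITED at every datum by §2 (plan C-R33 / K4: binder of class refuted-closure replaced by an inhabited
  instance form).
* §4 `prop26_schema_refuted_and_inner_instances` — the census pair in one statement (universe `0`): the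
  ∀-closure of `Prop26` is false for every odd `l ≠ 1` AND the inner instance forms hold for every datum.

HONEST FRAMING. `T.Prop26` itself (every `γ`) is NOT proved here for any datum and is not claimed: its content
is print's anabelian input (the `K`-core / [SemiAnbd] Thm. 6.8 (ii)), which the abstract interface does not
carry; the κ′ refutation concerns a semi-synthetic inhabitant of OUR interface (trivial Galois action on the
geometric part), not print. Typed ≠ proved; instantiated ≠ endorsed; no side is taken on [IUTchIII] Cor. 3.12.
-/

namespace Literature.AnabelianGeometry.EtaleTheta

open Literature.AlgebraicGeometry.Frobenioids (IsSlimGroup)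

namespace ThetaCovers

universe u

/-! ### §0 Group theory: inner automorphisms as continuous multiplicative equivalences -/

section GroupTheory

variable {G : Type*} [Group G] [TopologicalSpace G] [IsTopologicalGroup G]

/-- The inner automorphism `g ↦ n g n⁻¹` of a topological group is a continuous multiplicative
self-equivalence (term built inside the proof; no definition is introduced). [folklore] -/
private theorem exists_continuousMulEquiv_inner (n : G) : ∃ Γ : G ≃ₜ* G, ∀ g : G, Γ g = n * g * n⁻¹ :=
  ⟨{ MulAut.conj n with
      continuous_toFun := by
        change Continuous fun h => n * h * n⁻¹
        fun_prop
      continuous_invFun := by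
        change Continuous fun h => n⁻¹ * h * n
        fun_prop }, fun _ => rfl⟩

/-- The inner automorphism by an element `n` of the normaliser of a subgroup `H` restricts to a continuous
multiplicative self-equivalence of `H` (term built inside the proof). [folklore] -/
private theorem exists_continuousMulEquiv_inner_restrict {H : Subgroup G} {n : G} (hn : n ∈ Subgroup.normalizer (H : Set G)) :
    ∃ γ : H ≃ₜ* H, ∀ x : H, ((γ x : H) : G) = n * x * n⁻¹ := by
  have hmem : ∀ x : G, x ∈ H → n * x * n⁻¹ ∈ H := fun x hx => (Subgroup.mem_normalizer_iff.mp hn x).mp hx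
  have hmem' : ∀ x : G, x ∈ H → n⁻¹ * x * n ∈ H := fun x hx => by
    have h := (Subgroup.mem_normalizer_iff.mp hn (n⁻¹ * x * n)).mpr
    apply h
    have : n * (n⁻¹ * x * n) * n⁻¹ = x := by group
    rw [this]
    exact hx
  refine ⟨{ toFun := fun x => ⟨n * x * n⁻¹, hmem x x.2⟩
            invFun := fun x => ⟨n⁻¹ * x * n, hmem' x x.2⟩
            left_inv := fun x => by ext; group
            right_inv := fun x => by ext; group
            map_mul' := fun x y => by ext; simp only [Subgroup.coe_mul]; group
            continuous_toFun := by
              apply Continuous.subtype_mk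
              exact (continuous_const.mul continuous_subtype_val).mul continuous_const
            continuous_invFun := by
              apply Continuous.subtype_mk
              exact (continuous_const.mul continuous_subtype_val).mul continuous_const }, fun _ => rfl⟩

omit [TopologicalSpace G] [IsTopologicalGroup G] in
/-- An inner automorphism by an element of the normaliser of `H` stabilises `H`. [folklore] -/
private theorem map_eq_self_of_inner_of_mem_normalizer {H : Subgroup G} (Γ : G ≃* G) {n : G}
    (hΓ : ∀ g : G, Γ g = n * g * n⁻¹) (hn : n ∈ Subgroup.normalizer (H : Set G)) : H.map Γ.toMonoidHom = H := by
  ext y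
  constructor
  · rintro ⟨x, hx, rfl⟩
    change Γ x ∈ H
    rw [hΓ]
    exact (Subgroup.mem_normalizer_iff.mp hn x).mp hx
  · intro hy
    refine ⟨n⁻¹ * y * n, ?_, ?_⟩
    · apply (Subgroup.mem_normalizer_iff.mp hn (n⁻¹ * y * n)).mpr
      have : n * (n⁻¹ * y * n) * n⁻¹ = y := by group
      rw [this]
      exact hy
    · change Γ (n⁻¹ * y * n) = y
      rw [hΓ]
      group

omit [TopologicalSpace G] [IsTopologicalGroup G] in
/-- The normaliser of `H` normalises `H ⊓ N` for a normal subgroup `N`. [folklore] -/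
private theorem normalizer_le_normalizer_inf_of_normal (H N : Subgroup G) [hN : N.Normal] :
    Subgroup.normalizer (H : Set G) ≤ Subgroup.normalizer ((H ⊓ N : Subgroup G) : Set G) := by
  intro n hn
  rw [Subgroup.mem_normalizer_iff] at hn ⊢
  intro x
  simp only [Subgroup.mem_inf]
  constructor
  · rintro ⟨hxH, hxN⟩
    exact ⟨(hn x).mp hxH, hN.conj_mem x hxN n⟩
  · rintro ⟨hxH, hxN⟩
    refine ⟨(hn x).mpr hxH, ?_⟩
    have h := hN.conj_mem _ hxN n⁻¹
    have : n⁻¹ * (n * x * n⁻¹) * n⁻¹⁻¹ = x := by group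
    rwa [this] at h

end GroupTheory

namespace TemperedCoverData

variable {l : ℕ} (T : TemperedCoverData.{u} l)

/-- `Π^tp_Ċ` is normal in `Π^tp_C` (index `2`). [cite: MochizukiEtTh2009, Def 2.5(ii) p.39] -/
theorem PiCdot_normal : T.PiCdot.Normal := Subgroup.normal_of_index_eq_two T.index_PiCdot

/-- The normaliser of a member `Π^tp_Z` normalises the dotted member `Π^tp_Ż = Π^tp_Z ∩ Π^tp_Ċ`.
[cite: MochizukiEtTh2009, Prop 2.6 p.40] -/
theorem normalizer_le_normalizer_inf_PiCdot (Z : Subgroup T.Gtp) :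
    Subgroup.normalizer (Z : Set T.Gtp) ≤ Subgroup.normalizer ((Z ⊓ T.PiCdot : Subgroup T.Gtp) : Set T.Gtp) := by
  haveI := T.PiCdot_normal
  exact normalizer_le_normalizer_inf_of_normal Z T.PiCdot

/-! ### §1 Pointwise reduction of the printed conclusion to print's anabelian input (one member, one `γ`) -/

/-- **Prop. 2.6 for ONE member and ONE `γ`, from an extension stabilising `Z` and `Ċ`.** If `γ ∈ Aut(Π^tp_Ż)`
is the restriction of an automorphism `Γ` of `Π^tp_C` with `Γ(Π^tp_Z) = Π^tp_Z` and `Γ(Π^tp_Ċ) = Π^tp_Ċ`, then the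
printed conclusion holds for `(Z, γ)`: `Γ` stabilises `Π^tp_Ż` automatically (`map_eq_self_of_restricts`). The
extension is print's input ([SemiAnbd] Thm. 6.8 (ii) at the `K`-core `C`), taken here as the binder `Γ, hΓ`.
[cite: MochizukiEtTh2009, Prop 2.6 p.40] -/
theorem extendsStabilising_dotted_of_extension {Z : Subgroup T.Gtp} (γ : ↥(Z ⊓ T.PiCdot) ≃ₜ* ↥(Z ⊓ T.PiCdot))
    (Γ : T.Gtp ≃ₜ* T.Gtp) (hΓ : ∀ h : ↥(Z ⊓ T.PiCdot), Γ h = γ h)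
    (hZst : Z.map Γ.toMulEquiv.toMonoidHom = Z) (hCst : T.PiCdot.map Γ.toMulEquiv.toMonoidHom = T.PiCdot) :
    T.ExtendsStabilising _ γ [Z ⊓ T.PiCdot, Z, T.PiCdot] := by
  refine ⟨Γ, hΓ, fun S hS => ?_⟩
  simp only [List.mem_cons, List.mem_nil_iff, or_false] at hS
  rcases hS with rfl | rfl | rfl
  · exact map_eq_self_of_restricts Γ.toMulEquiv γ.toMulEquiv hΓ
  · exact hZst
  · exact hCst

/-- **Prop. 2.6 for ONE `C`-member (`Ċ̲̲` or `Ċ̲`) and ONE `γ`, from an extension stabilising `Z` only**: the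
`Ċ`-clause is group theory there (`4 ∤ [Π^tp_C : Π^tp_Ż] = 2l², 2l`, `map_PiCdot_eq_of_map_inf_PiCdot_eq`).
What print's hypotheses leave for these members is exactly: an extension `Γ` of `γ` with `Γ(Π^tp_Z) = Π^tp_Z`.
[cite: MochizukiEtTh2009, Prop 2.6 p.40] -/
theorem extendsStabilising_dotted_of_extension_C {Z : Subgroup T.Gtp} (hZ : Z ∈ [T.tp T.PiCuu, T.tp T.PiCu])
    (γ : ↥(Z ⊓ T.PiCdot) ≃ₜ* ↥(Z ⊓ T.PiCdot)) (Γ : T.Gtp ≃ₜ* T.Gtp) (hΓ : ∀ h : ↥(Z ⊓ T.PiCdot), Γ h = γ h)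
    (hZst : Z.map Γ.toMulEquiv.toMonoidHom = Z) :
    T.ExtendsStabilising _ γ [Z ⊓ T.PiCdot, Z, T.PiCdot] :=
  T.extendsStabilising_dotted_of_extension γ Γ hΓ hZst
    (T.map_PiCdot_eq_of_map_inf_PiCdot_eq Γ hZ (map_eq_self_of_restricts Γ.toMulEquiv γ.toMulEquiv hΓ))

/-! ### §2 The inner instance forms: inhabited for every datum -/

/-- **Prop. 2.6 holds for `γ` the restriction of an INNER automorphism of `Π^tp_C` by any `n` normalising
`Π^tp_Z`** (every member `Z`, every datum): the extension is that inner automorphism, which stabilises `Π^tp_Z`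
(`n ∈ N(Π^tp_Z)`), `Π^tp_Ċ` (normal, index `2`) and `Π^tp_Ż` (restriction). This is the instance «isomorphisms of
fundamental groups arising from isomorphisms of the orbicurves in question» of Remark 2.6.1.
[cite: MochizukiEtTh2009, Prop 2.6 p.40] -/
theorem extendsStabilising_dotted_of_inner {Z : Subgroup T.Gtp} {n : T.Gtp} (hn : n ∈ Subgroup.normalizer (Z : Set T.Gtp))
    (γ : ↥(Z ⊓ T.PiCdot) ≃ₜ* ↥(Z ⊓ T.PiCdot)) (hres : ∀ x : ↥(Z ⊓ T.PiCdot), ((γ x : ↥(Z ⊓ T.PiCdot)) : T.Gtp) = n * x * n⁻¹) :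
    T.ExtendsStabilising _ γ [Z ⊓ T.PiCdot, Z, T.PiCdot] := by
  haveI := T.PiCdot_normal
  obtain ⟨Γ, hΓ⟩ := exists_continuousMulEquiv_inner n
  refine T.extendsStabilising_dotted_of_extension γ Γ (fun h => by rw [hΓ, hres]) ?_ ?_
  · exact map_eq_self_of_inner_of_mem_normalizer Γ.toMulEquiv hΓ hn
  · exact map_eq_self_of_inner_of_mem_normalizer Γ.toMulEquiv hΓ
      (Subgroup.le_normalizer_of_normal (H := T.PiCdot) (K := ⊤) (Subgroup.mem_top n))

/-- **The inner instance form is INHABITED**: for every `n` normalising `Π^tp_Z` the restricted inner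
automorphism `γ_n ∈ Aut(Π^tp_Ż)` exists and satisfies the printed conclusion. [cite: MochizukiEtTh2009, Prop 2.6 p.40] -/
theorem exists_extendsStabilising_dotted_of_mem_normalizer {Z : Subgroup T.Gtp} {n : T.Gtp}
    (hn : n ∈ Subgroup.normalizer (Z : Set T.Gtp)) :
    ∃ γ : ↥(Z ⊓ T.PiCdot) ≃ₜ* ↥(Z ⊓ T.PiCdot),
      (∀ x : ↥(Z ⊓ T.PiCdot), ((γ x : ↥(Z ⊓ T.PiCdot)) : T.Gtp) = n * x * n⁻¹) ∧
        T.ExtendsStabilising _ γ [Z ⊓ T.PiCdot, Z, T.PiCdot] := by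
  obtain ⟨γ, hγ⟩ := exists_continuousMulEquiv_inner_restrict (T.normalizer_le_normalizer_inf_PiCdot Z hn)
  exact ⟨γ, hγ, T.extendsStabilising_dotted_of_inner hn γ hγ⟩

/-- In particular for `n ∈ Π^tp_Z` itself (deck-type inner automorphisms of `Ż → Z`).
[cite: MochizukiEtTh2009, Prop 2.6 p.40] -/
theorem exists_extendsStabilising_dotted_of_mem {Z : Subgroup T.Gtp} {n : T.Gtp} (hn : n ∈ Z) :
    ∃ γ : ↥(Z ⊓ T.PiCdot) ≃ₜ* ↥(Z ⊓ T.PiCdot),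
      (∀ x : ↥(Z ⊓ T.PiCdot), ((γ x : ↥(Z ⊓ T.PiCdot)) : T.Gtp) = n * x * n⁻¹) ∧
        T.ExtendsStabilising _ γ [Z ⊓ T.PiCdot, Z, T.PiCdot] :=
  T.exists_extendsStabilising_dotted_of_mem_normalizer (Subgroup.le_normalizer hn)

/-- **Prop. 2.6 at `γ = id`** (every member, every datum): `Γ := id`. [cite: MochizukiEtTh2009, Prop 2.6 p.40] -/
theorem extendsStabilising_dotted_refl (Z : Subgroup T.Gtp) :
    T.ExtendsStabilising _ (ContinuousMulEquiv.refl ↥(Z ⊓ T.PiCdot)) [Z ⊓ T.PiCdot, Z, T.PiCdot] :=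
  T.extendsStabilising_dotted_of_inner (n := 1) (Subgroup.one_mem _) _ fun x => by simp

/-! ### §3 The node's closer of record `prop26_existsUnique`, re-closed pointwise -/

/-- **`prop26_existsUnique` RE-CLOSED POINTWISE**: under temp-slimness of `Π^tp_C`, for a member `Z` and an
automorphism `γ` of `Π^tp_Ż` satisfying the printed conclusion (the pointwise instance of `Prop26`), the extension
to `Π^tp_C` stabilising `[Ż, Z, Ċ]` is UNIQUE — the conclusion of abc-iut-L2-t7's `prop26_existsUnique` with its
binder `h : T.Prop26` (F-0610, refuted-closure class) replaced by the instance at `(Z, γ)`.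
[cite: MochizukiEtTh2009, Prop 2.6 p.40] -/
theorem existsUnique_extension_dotted_of_extendsStabilising (hslim : IsSlimGroup T.Gtp) {Z : Subgroup T.Gtp}
    (hZ : Z ∈ [T.tp T.PiXuu, T.tp T.PiXu, T.tp T.PiCuu, T.tp T.PiCu])
    (γ : ↥(Z ⊓ T.PiCdot) ≃ₜ* ↥(Z ⊓ T.PiCdot)) (h : T.ExtendsStabilising _ γ [Z ⊓ T.PiCdot, Z, T.PiCdot]) :
    ∃! Γ : T.Gtp ≃ₜ* T.Gtp, (∀ x : ↥(Z ⊓ T.PiCdot), Γ x = γ x) ∧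
      ∀ S ∈ [Z ⊓ T.PiCdot, Z, T.PiCdot], S.map Γ.toMulEquiv.toMonoidHom = S :=
  T.existsUnique_of_extendsStabilising hslim (T.isOpen_inf_PiCdot_of_mem_four hZ) h

/-- **The re-closed closer at the INNER instance** (binder-free beyond temp-slimness): for `n` normalising
`Π^tp_Z` and `γ` its restriction to `Π^tp_Ż`, the extension stabilising `[Ż, Z, Ċ]` exists AND is unique.
[cite: MochizukiEtTh2009, Prop 2.6 p.40] -/
theorem existsUnique_extension_dotted_of_inner (hslim : IsSlimGroup T.Gtp) {Z : Subgroup T.Gtp}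
    (hZ : Z ∈ [T.tp T.PiXuu, T.tp T.PiXu, T.tp T.PiCuu, T.tp T.PiCu]) {n : T.Gtp} (hn : n ∈ Subgroup.normalizer (Z : Set T.Gtp))
    (γ : ↥(Z ⊓ T.PiCdot) ≃ₜ* ↥(Z ⊓ T.PiCdot)) (hres : ∀ x : ↥(Z ⊓ T.PiCdot), ((γ x : ↥(Z ⊓ T.PiCdot)) : T.Gtp) = n * x * n⁻¹) :
    ∃! Γ : T.Gtp ≃ₜ* T.Gtp, (∀ x : ↥(Z ⊓ T.PiCdot), Γ x = γ x) ∧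
      ∀ S ∈ [Z ⊓ T.PiCdot, Z, T.PiCdot], S.map Γ.toMulEquiv.toMonoidHom = S :=
  T.existsUnique_extension_dotted_of_extendsStabilising hslim hZ γ (T.extendsStabilising_dotted_of_inner hn γ hres)

/-- **The re-closed closer at `γ = id`**: the identity is the UNIQUE automorphism of a temp-slim `Π^tp_C`
restricting to the identity of `Π^tp_Ż` (and it stabilises `[Ż, Z, Ċ]`). [cite: MochizukiEtTh2009, Prop 2.6 p.40] -/
theorem existsUnique_extension_dotted_refl (hslim : IsSlimGroup T.Gtp) {Z : Subgroup T.Gtp}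
    (hZ : Z ∈ [T.tp T.PiXuu, T.tp T.PiXu, T.tp T.PiCuu, T.tp T.PiCu]) :
    ∃! Γ : T.Gtp ≃ₜ* T.Gtp, (∀ x : ↥(Z ⊓ T.PiCdot), Γ x = x) ∧
      ∀ S ∈ [Z ⊓ T.PiCdot, Z, T.PiCdot], S.map Γ.toMulEquiv.toMonoidHom = S :=
  T.existsUnique_extension_dotted_of_extendsStabilising hslim hZ (ContinuousMulEquiv.refl _)
    (T.extendsStabilising_dotted_refl Z)

end TemperedCoverData

/-! ### §4 The census pair: schema refuted, inner instances inhabited -/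

/-- **Census pair for F-0610 / node EtTh:Prop2.6** (universe `0`, odd `l ≠ 1`, `[NeZero l]` as in the refutation): the universal closure of the
typed `Prop26` is FALSE over the interface (`TemperedModel.not_forall_prop26`, the twisted model), while the
inner instance forms of its conclusion hold for EVERY datum and EVERY member (§2). Refuted-closure ≠ refuted
paper; the instance at an arbitrary `γ` is print's anabelian input and is not claimed.
[cite: MochizukiEtTh2009, Prop 2.6 p.40] -/
theorem prop26_schema_refuted_and_inner_instances {l : ℕ} [NeZero l] (hl : Odd l) (hl1 : l ≠ 1) :
    (¬ ∀ T : TemperedCoverData.{0} l, T.Prop26) ∧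
      ∀ (T : TemperedCoverData.{0} l) (Z : Subgroup T.Gtp) (n : T.Gtp), n ∈ Subgroup.normalizer (Z : Set T.Gtp) →
        ∃ γ : ↥(Z ⊓ T.PiCdot) ≃ₜ* ↥(Z ⊓ T.PiCdot),
          (∀ x : ↥(Z ⊓ T.PiCdot), ((γ x : ↥(Z ⊓ T.PiCdot)) : T.Gtp) = n * x * n⁻¹) ∧
            T.ExtendsStabilising _ γ [Z ⊓ T.PiCdot, Z, T.PiCdot] :=
  ⟨TemperedModel.not_forall_prop26 l hl hl1, fun T _ _ hn => T.exists_extendsStabilising_dotted_of_mem_normalizer hn⟩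

end ThetaCovers

end Literature.AnabelianGeometry.EtaleTheta
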